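import Literature.NumberTheory.LFunctions.ExceptionalCharacters
import Literature.NumberTheory.LFunctions.NoRealZeroUpTo
import Literature.NumberTheory.LFunctions.SiegelZerosPrimeTuples
import HarnessLib
import Summits.Parity.GeneralizedHardyLittlewood.Theorems.UnboundedSiegelZeros

/-!
# Exceptional zeros ⇒ large gaps between consecutive primes (Ford 2020)

Statement layer for the «illusory world» column (conditional consequences of exceptional zeros),
topic «prime gaps». Source: K. Ford, *Large prime gaps and progressions with few primes*, Riv.
Mat. Univ. Parma (N.S.) 12 (2021) 41–47 [Ford2019LargePrimeGaps]; held copy = arXiv:1907.11994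
(tex), §1: Theorem 1.1, Corollary 1.2, Proposition 1.3 (Gallagher), Theorem 1.4 and the displayed
example after it.

`G(x)` denotes the largest gap between consecutive primes below `x`; the best unconditional
lower bound is Ford–Green–Konyagin–Maynard–Tao's `G(x) ≫ log x · log₂x · log₄x / log₃x`. Ford's
Theorem 1.4: a real zero `L(1 − δ, χ) = 0` of a real character of conductor `q` gives
`G(e^{2u}) ≫ u/(δ log u)` for some `u` with `log u ≍ log q`; so (the displayed example) if for a
fixed `k` there are infinitely many exceptional zeros with `δ_q ≤ (log q)^{−k}`, then
`G(X) ≫_k (log X)(log₂ X)^{k−1}` on an unbounded set of `X`, beating FGKMT for `k ≥ 2`.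

* `ford2020_theorem14` — NAMED FACT, Theorem 1.4 AS PRINTED, with `G(e^{2u}) ≥ y` rendered as
  «there are consecutive primes `p_n < p_{n+1} ≤ e^{2u}` with `p_{n+1} − p_n ≥ y`» (the tree has
  no `G`; cf. `Literature.NumberTheory.Sieve.ParityWave0`'s gap statements on `Nat.nth Nat.Prime`),
  `log u ≍ log q` as `A log q ≤ log u ≤ B log q`, and «`q` sufficiently large» made explicit (the
  paper's Theorem 1.1 is stated for large `x = q^B`);
* `Ford2020.PolylogExceptionalZeros k` — the HYPOTHESIS of the displayed example («there exist
  infinitely many exceptional zeros `δ = δ_q` satisfying `δ_q ≤ (log q)^{−k}`»), a PREDICATE in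
  `k`, never asserted; PROVED comparisons with the column's family: monotone in `k` (`.anti`);
  `k > 1` ⇒ Tao–Teräväinen's `UnboundedSiegelZeros` (`.unboundedSiegelZeros`: quality
  `η = 1/(δ log q) ≥ (log q)^{k−1} → ∞`); exceptional characters of strength `k + 1` ⇒ exponent `k`
  (`.of_strength`, the tree's PROVED Hecke–Landau converse); every witness lies above a certified
  table `NoRealZeroUpTo Q` (`.witness_above`). (Wright's `StrongSiegelZeros A` of
  `SiegelZerosPrimeTuples.lean` is the case `δ < (log D)^{−(r^r + A)}` of the same shape — PROVED
  comparison `WrightPrimeTuples.StrongSiegelZeros.polylogExceptionalZeros`, appended 2026-08-26: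
  `StrongSiegelZeros A → PolylogExceptionalZeros (r^r + A)` for `A ≥ 0`, so Wright's hypothesis
  inherits the large-gap consequence with exponent `k = r^r + A`.)
* PROVED: **`Ford2020.largeGaps_of_polylogExceptionalZeros`** — the displayed example DERIVED from
  Theorem 1.4: `ford2020_theorem14 → PolylogExceptionalZeros k → (k ≥ 1) →
  ∃ C > 0, ∀ X₀, ∃ X ≥ X₀, G(X) ≥ C log X (log log X)^{k−1}`.

Index only: Theorem 1.1 (unconditional: `π(x; q, b) ≤ δx/φ(q)` ⇒ `G(e^{2u}) ≥ J(u) ≥ (x−b)/q`,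
Jacobsthal's function), Corollary 1.2 (`L(q,b) > x ⇒ G(e^{4√x}) ≥ (x − b)/q`), Proposition 1.3
(Gallagher's prime number theorem with an exceptional zero — the tree's
`Literature.NumberTheory.LFunctions.PagePNTWithExceptionalZero` family is the `ψ`-form).

LABEL: instrument / statement layer. WHAT THIS IS NOT: no claim that exceptional zeros exist; under
GRH the hypothesis is void and nothing here improves FGKMT unconditionally.

## References

* [Ford2019LargePrimeGaps] K. Ford, *Large prime gaps and progressions with few primes*, Riv. Mat.
  Univ. Parma (N.S.) 12 (2021), no. 1, 41–47 = arXiv:1907.11994: §1 Theorems 1.1, 1.4,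
  Corollary 1.2, Proposition 1.3 and the example after Theorem 1.4.
* [TaoTeravainen2021] T. Tao, J. Teräväinen, JLMS 106 (2022), Definition 1.4 (quality of a Siegel
  zero; `UnboundedSiegelZeros`).
* [MontgomeryVaughan2007] H. L. Montgomery, R. C. Vaughan, *Multiplicative Number Theory I*,
  Theorem 11.4 (11.10) (the converse `1 − β₁ ≪ L(1,χ)`, as proved in the tree).
-/

noncomputable section

open Real
open Literature.Barriers.Parity

namespace Literature.NumberTheory.LFunctions

namespace Ford2020

/-- **Ford's example hypothesis** («if `k` is fixed and there exist infinitely many exceptional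
zeros `δ = δ_q` satisfying `δ_q ≤ (log q)^{−k}`»): for every `q₀` there are a conductor `q ≥ q₀`,
a primitive quadratic `χ` mod `q` and `0 < δ < 1` with `L(1 − δ, χ) = 0` and `δ ≤ (log q)^{−k}`.
A PREDICATE in `k`, never asserted (expected false: for `k > 1` it implies `UnboundedSiegelZeros`,
`PolylogExceptionalZeros.unboundedSiegelZeros`). [cite: Ford2019LargePrimeGaps, §1, example after Theorem 1.4] -/
def PolylogExceptionalZeros (k : ℝ) : Prop :=
  ∀ q₀ : ℕ, ∃ (q : ℕ) (_ : NeZero q) (χ : DirichletCharacter ℂ q) (δ : ℝ),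
    q₀ ≤ q ∧ χ.IsPrimitive ∧ χ.IsQuadratic ∧ 0 < δ ∧ δ < 1 ∧
      χ.LFunction (1 - (δ : ℂ)) = 0 ∧ δ ≤ Real.log q ^ (-k)

end Ford2020

/-- **Ford 2020, Theorem 1.4** (NAMED FACT, AS PRINTED): «Suppose that `χ` is a real character with
conductor `q` and that `L(1 − δ, χ) = 0` for some `0 < δ < 1`. Then `G(e^{2u}) ≫ u/(δ log u)` for
some `u` satisfying `log u ≍ log q`», `G(x)` = the largest gap between consecutive primes below
`x`. Rendered with absolute constants `c > 0`, `0 < A ≤ B` and a threshold `q₀` («`x` large» in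
the paper's Theorem 1.1, applied at `x = q^B`): for `q ≥ q₀`, `χ` primitive quadratic mod `q` (the
real character of conductor `q`) and such a `δ`, there are `u > 0` («the smallest integer with
`u > 2√x` and …») with `A log q ≤ log u ≤ B log q`
and consecutive primes `p_n < p_{n+1} ≤ e^{2u}` with `p_{n+1} − p_n ≥ c · u/(δ log u)`. Not proved
here (Gallagher's prime number theorem with the exceptional zero, Proposition 1.3, and the
covering argument of Theorem 1.1). [cite: Ford2019LargePrimeGaps, §1 Theorem 1.4] -/
def ford2020_theorem14 : Prop :=
  ∃ (c A B : ℝ), 0 < c ∧ 0 < A ∧ A ≤ B ∧ ∃ q₀ : ℕ,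
    ∀ (q : ℕ) [NeZero q] (χ : DirichletCharacter ℂ q) (δ : ℝ), q₀ ≤ q →
      χ.IsPrimitive → χ.IsQuadratic → 0 < δ → δ < 1 → χ.LFunction (1 - (δ : ℂ)) = 0 →
      ∃ u : ℝ, 0 < u ∧ A * Real.log q ≤ Real.log u ∧ Real.log u ≤ B * Real.log q ∧
        ∃ n : ℕ, (Nat.nth Nat.Prime (n + 1) : ℝ) ≤ Real.exp (2 * u) ∧
          c * (u / (δ * Real.log u)) ≤ (Nat.nth Nat.Prime (n + 1) : ℝ) - Nat.nth Nat.Prime n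

namespace Ford2020

/-! ### PROVED comparisons of the hypothesis with the column's family -/

/-- For `q ≥ 3`, `1 < log q`. [folklore] -/
private theorem one_lt_log_of_three_le {q : ℕ} (hq : 3 ≤ q) : 1 < Real.log q := by
  have hq3 : (3 : ℝ) ≤ (q : ℝ) := by exact_mod_cast hq
  have hlog3 : 1 < Real.log 3 := by
    have h := Real.exp_one_lt_d9
    rw [Real.lt_log_iff_exp_lt (by norm_num)]
    linarith
  exact lt_of_lt_of_le hlog3 (Real.log_le_log (by norm_num) hq3)

/-- A larger exponent is a stronger hypothesis: exponent `k'` implies exponent `k ≤ k'` (take the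
witnesses of conductor `≥ 3`, where `log q > 1`). [cite: Ford2019LargePrimeGaps, §1, example after Theorem 1.4] -/
theorem PolylogExceptionalZeros.anti {k k' : ℝ} (hkk : k ≤ k') (h : PolylogExceptionalZeros k') :
    PolylogExceptionalZeros k := by
  intro q₀
  obtain ⟨q, hqne, χ, δ, hq, hprim, hquad, hδ0, hδ1, hzero, hδk⟩ := h (max q₀ 3)
  have hq3 : 3 ≤ q := le_trans (le_max_right _ _) hq
  have hlog1 : 1 < Real.log q := one_lt_log_of_three_le hq3
  refine ⟨q, hqne, χ, δ, le_trans (le_max_left _ _) hq, hprim, hquad, hδ0, hδ1, hzero, ?_⟩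
  exact hδk.trans (Real.rpow_le_rpow_of_exponent_le hlog1.le (by linarith))

/-- **Ford's hypothesis with `k > 1` implies Tao–Teräväinen's `UnboundedSiegelZeros`**: the zero
`1 − δ` with `δ ≤ (log q)^{−k}` has quality `η = 1/(δ log q) ≥ (log q)^{k−1}`, unbounded along the
witnesses. [cite: Ford2019LargePrimeGaps, §1, example after Theorem 1.4] [cite: TaoTeravainen2021, Definition 1.4] -/
theorem PolylogExceptionalZeros.unboundedSiegelZeros {k : ℝ} (hk : 1 < k)
    (h : PolylogExceptionalZeros k) : Summit.Parity.GeneralizedHardyLittlewood.UnboundedSiegelZeros := by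
  intro η₀ q₀
  -- the quality wanted and a conductor threshold with `(log q)^{k-1} ≥ T`
  set T : ℝ := max η₀ 10 with hTdef
  have hT10 : 10 ≤ T := le_max_right _ _
  have hTpos : 0 < T := by linarith
  have hk1 : 0 < k - 1 := by linarith
  set L : ℝ := T ^ (1 / (k - 1)) with hLdef
  have hL0 : 0 ≤ L := Real.rpow_nonneg hTpos.le _
  obtain ⟨q, hqne, χ, δ, hq, hprim, hquad, hδ0, hδ1, hzero, hδk⟩ :=
    h (max q₀ (⌈Real.exp L⌉₊ + 3))
  have hq3 : 3 ≤ q := by have := le_trans (le_max_right _ _) hq; omega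
  have hlog1 : 1 < Real.log q := one_lt_log_of_three_le hq3
  have hlog0 : 0 < Real.log q := by linarith
  -- `L ≤ log q`, hence `T ≤ (log q)^{k-1}`
  have hLlog : L ≤ Real.log q := by
    have hqexp : Real.exp L ≤ (q : ℝ) := by
      have h1 : Real.exp L ≤ (⌈Real.exp L⌉₊ : ℝ) := Nat.le_ceil _
      have h2 : ((⌈Real.exp L⌉₊ + 3 : ℕ) : ℝ) ≤ (q : ℝ) := by
        exact_mod_cast le_trans (le_max_right _ _) hq
      push_cast at h2
      linarith
    rw [Real.le_log_iff_exp_le (by positivity)]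
    exact hqexp
  have hTle : T ≤ Real.log q ^ (k - 1) := by
    have h1 : L ^ (k - 1) ≤ Real.log q ^ (k - 1) := Real.rpow_le_rpow hL0 hLlog hk1.le
    have h2 : L ^ (k - 1) = T := by
      rw [hLdef, ← Real.rpow_mul hTpos.le, one_div_mul_cancel hk1.ne', Real.rpow_one]
    rw [h2] at h1
    exact h1
  -- the quality `η = 1/(δ log q) ≥ (log q)^{k-1}`
  set η : ℝ := 1 / (δ * Real.log q) with hηdef
  have hηpos : 0 < η := by positivity
  have hpowk : 0 < Real.log q ^ k := Real.rpow_pos_of_pos hlog0 _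
  have hδk' : δ ≤ 1 / Real.log q ^ k := by
    rwa [Real.rpow_neg hlog0.le, ← one_div] at hδk
  have hηge : Real.log q ^ (k - 1) ≤ η := by
    -- `(log q)^{k-1} = (log q)^k / log q` and `δ log q ≤ (log q)^k⁻¹ · log q`
    have hsplit : Real.log q ^ (k - 1) = Real.log q ^ k / Real.log q := by
      rw [Real.rpow_sub hlog0, Real.rpow_one]
    rw [hsplit, hηdef, div_le_div_iff₀ hlog0 (by positivity)]
    have : δ * Real.log q ^ k ≤ 1 := by
      have := mul_le_mul_of_nonneg_right hδk' hpowk.le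
      rwa [one_div, inv_mul_cancel₀ hpowk.ne'] at this
    nlinarith
  have hTη : T ≤ η := hTle.trans hηge
  -- the zero `1 - δ = 1 - 1/(η log q)`
  have hδne : δ ≠ 0 := hδ0.ne'
  have hlogne : Real.log q ≠ 0 := hlog0.ne'
  have harg : (1 - 1 / (η * Real.log q) : ℝ) = 1 - δ := by
    rw [hηdef]
    field_simp
  refine ⟨q, hqne, χ, η, le_trans (le_max_left _ _) hq, (le_max_left _ _).trans hTη, hprim, hquad,
    hT10.trans hTη, ?_⟩
  rw [harg]
  push_cast
  exact hzero

/-- **Exceptional characters of strength `k + 1` give Ford's hypothesis with exponent `k`**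
(`k ≥ 2`), by the tree's PROVED Hecke–Landau converse
(`exists_exceptionalZero_of_norm_LFunction_one_lt`: `‖L(1,χ)‖ < A₀/log²(4q)` ⇒ a real zero `β₁`
with `1 − β₁ ≤ K‖L(1,χ)‖`): `‖L(1,χ)‖ ≤ (log q)^{−k−1}` at a large conductor gives
`1 − β₁ ≤ K(log q)^{−k−1} < (log q)^{−k}`. [cite: Ford2019LargePrimeGaps, §1 Theorem 1.4] [cite: MontgomeryVaughan2007, Theorem 11.4 (11.10)] -/
theorem PolylogExceptionalZeros.of_strength {k : ℝ} (hk : 2 ≤ k)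
    (h : ExceptionalCharactersOfStrength (k + 1)) : PolylogExceptionalZeros k := by
  intro q₀
  obtain ⟨c, hc, A₀, hA₀, K, hK, hH⟩ := exists_exceptionalZero_of_norm_LFunction_one_lt
  -- threshold: `log q > max K (4/A₀)` (and `q ≥ 4`)
  set T : ℝ := max K (4 / A₀) + 1 with hTdef
  obtain ⟨q, hqne, χ, hq, hprim, hne, hquad, hL⟩ := h (max q₀ (⌈Real.exp T⌉₊ + 4))
  have hq4 : 4 ≤ q := by have := le_trans (le_max_right _ _) hq; omega
  have hq3 : 3 ≤ q := by omega
  have hlog1 : 1 < Real.log q := one_lt_log_of_three_le hq3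
  have hlog0 : 0 < Real.log q := by linarith
  have hlogT : T ≤ Real.log q := by
    have hqexp : Real.exp T ≤ (q : ℝ) := by
      have h1 : Real.exp T ≤ (⌈Real.exp T⌉₊ : ℝ) := Nat.le_ceil _
      have h2 : ((⌈Real.exp T⌉₊ + 4 : ℕ) : ℝ) ≤ (q : ℝ) := by
        exact_mod_cast le_trans (le_max_right _ _) hq
      push_cast at h2
      linarith
    rw [Real.le_log_iff_exp_le (by positivity)]
    exact hqexp
  have hlogK : K < Real.log q := by
    have : K ≤ max K (4 / A₀) := le_max_left _ _
    linarith
  have hlogA : 4 / A₀ < Real.log q := by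
    have : 4 / A₀ ≤ max K (4 / A₀) := le_max_right _ _
    linarith
  -- powers of `log q`
  have hpowk : 0 < Real.log q ^ k := Real.rpow_pos_of_pos hlog0 _
  have hsplit : Real.log q ^ (-(k + 1)) = 1 / (Real.log q ^ k * Real.log q) := by
    rw [Real.rpow_neg hlog0.le, Real.rpow_add_one hlog0.ne', one_div]
  have hL' : ‖χ.LFunction 1‖ ≤ 1 / (Real.log q ^ k * Real.log q) := by
    have hL2 : ‖χ.LFunction 1‖ ≤ Real.log q ^ (-(k + 1)) := hL
    rwa [hsplit] at hL2
  -- smallness needed by the converse theorem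
  have hlog4q : Real.log (4 * q) ≤ 2 * Real.log q := by
    have hq4r : (4 : ℝ) ≤ q := by exact_mod_cast hq4
    rw [Real.log_mul (by norm_num) (by positivity)]
    have : Real.log 4 ≤ Real.log q := Real.log_le_log (by norm_num) hq4r
    linarith
  have hlog4q0 : 0 < Real.log (4 * q) := by
    have : (1 : ℝ) < 4 * q := by
      have hq4r : (4 : ℝ) ≤ q := by exact_mod_cast hq4
      linarith
    exact Real.log_pos this
  have hsmall : ‖χ.LFunction 1‖ < A₀ / Real.log (4 * q) ^ 2 := by
    have hk' : Real.log q ^ (2 : ℝ) ≤ Real.log q ^ k :=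
      Real.rpow_le_rpow_of_exponent_le hlog1.le hk
    rw [Real.rpow_two] at hk'
    have h1 : 1 / (Real.log q ^ k * Real.log q) ≤ 1 / (Real.log q ^ 2 * Real.log q) :=
      one_div_le_one_div_of_le (by positivity) (mul_le_mul_of_nonneg_right hk' hlog0.le)
    have h2 : 1 / (Real.log q ^ 2 * Real.log q) < A₀ / (4 * Real.log q ^ 2) := by
      rw [div_lt_div_iff₀ (by positivity) (by positivity)]
      have : 4 < A₀ * Real.log q := by
        have := (div_lt_iff₀ hA₀).1 hlogA
        linarith [mul_comm A₀ (Real.log q)]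
      nlinarith [pow_pos hlog0 2]
    have h3 : A₀ / (4 * Real.log q ^ 2) ≤ A₀ / Real.log (4 * q) ^ 2 := by
      apply div_le_div_of_nonneg_left hA₀.le (by positivity)
      nlinarith
    linarith
  haveI := hqne
  obtain ⟨β₁, -, hβhi, hβzero, -, -, -, hβK, -⟩ := hH q χ hne hsmall
  -- `1 − β₁ ≤ K‖L(1,χ)‖ ≤ K/((log q)^k log q) < 1/(log q)^k`
  have hfin : 1 - β₁ < 1 / Real.log q ^ k := by
    calc 1 - β₁ ≤ K * ‖χ.LFunction 1‖ := hβK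
      _ ≤ K * (1 / (Real.log q ^ k * Real.log q)) := mul_le_mul_of_nonneg_left hL' hK.le
      _ < 1 / Real.log q ^ k := by
          rw [mul_one_div, div_lt_div_iff₀ (by positivity) hpowk]
          have : K * Real.log q ^ k < Real.log q ^ k * Real.log q := by
            rw [mul_comm]
            exact mul_lt_mul_of_pos_left hlogK hpowk
          nlinarith
  have hpow1 : Real.log q ≤ Real.log q ^ k := by
    calc Real.log q = Real.log q ^ (1 : ℝ) := (Real.rpow_one _).symm
      _ ≤ Real.log q ^ k := Real.rpow_le_rpow_of_exponent_le hlog1.le (by linarith)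
  have hsmall1 : 1 / Real.log q ^ k < 1 := by
    rw [div_lt_one hpowk]; linarith
  refine ⟨q, hqne, χ, 1 - β₁, le_trans (le_max_left _ _) hq, hprim, hquad, by linarith,
    by linarith, ?_, ?_⟩
  · have : (1 : ℂ) - ((1 - β₁ : ℝ) : ℂ) = (β₁ : ℂ) := by push_cast; ring
    rw [this]; exact hβzero
  · rw [Real.rpow_neg hlog0.le, ← one_div]
    exact hfin.le

/-- A certified wide table relocates the witnesses: under `NoRealZeroUpTo Q` every witness of
`PolylogExceptionalZeros k` of conductor `≥ 3` has conductor `> Q` (tail-only contrapositive; the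
table does NOT refute the hypothesis). [cite: Ford2019LargePrimeGaps, §1 Theorem 1.4] -/
theorem PolylogExceptionalZeros.witness_above {Q : ℕ} (hW : NoRealZeroUpTo Q) {q : ℕ} [NeZero q]
    (hq3 : 3 ≤ q) {χ : DirichletCharacter ℂ q} (hprim : χ.IsPrimitive) (hquad : χ.IsQuadratic)
    {δ : ℝ} (hδ0 : 0 < δ) (hδ1 : δ < 1) (hzero : χ.LFunction (1 - (δ : ℂ)) = 0) : Q < q := by
  by_contra hle
  rw [not_lt] at hle
  have h := hW q hq3 hle χ hquad hprim (1 - δ) (by linarith) (by linarith)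
  apply h
  have : (((1 - δ : ℝ)) : ℂ) = 1 - (δ : ℂ) := by push_cast; ring
  rw [this]; exact hzero

/-! ### The displayed example, PROVED from Theorem 1.4 -/

/-- **Ford 2020, the example after Theorem 1.4 — PROVED from Theorem 1.4**: «if `k` is fixed and
there exist infinitely many exceptional zeros `δ = δ_q` satisfying `δ_q ≤ (log q)^{−k}`, we see that
there is an unbounded set of `X` for which `G(X) ≫_k (log X)(log₂ X)^{k−1}`» (here `k ≥ 1` real;
`G(X) ≥ y` rendered as consecutive primes `p_n < p_{n+1} ≤ X` at distance `≥ y`). Proof: at a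
witness, Theorem 1.4 gives `u` with `A log q ≤ log u ≤ B log q` and a gap `≥ c·u/(δ log u)` below
`X = e^{2u}`; `1/δ ≥ (log q)^k ≥ (log u/B)^k`, so the gap is `≥ c B^{−k} u (log u)^{k−1}`, and
`u = ½ log X`, `log u ≥ ½ log log X` once `u ≥ 2`; `X ≥ u ≥ q^A` is unbounded.
[cite: Ford2019LargePrimeGaps, §1, example after Theorem 1.4] -/
theorem largeGaps_of_polylogExceptionalZeros (h : ford2020_theorem14) {k : ℝ} (hk : 1 ≤ k)
    (hz : PolylogExceptionalZeros k) :
    ∃ C : ℝ, 0 < C ∧ ∀ X₀ : ℝ, ∃ X : ℝ, X₀ ≤ X ∧ ∃ n : ℕ,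
      (Nat.nth Nat.Prime (n + 1) : ℝ) ≤ X ∧
        C * (Real.log X * Real.log (Real.log X) ^ (k - 1)) ≤
          (Nat.nth Nat.Prime (n + 1) : ℝ) - Nat.nth Nat.Prime n := by
  obtain ⟨c, A, B, hc, hA, hAB, q₀, hT⟩ := h
  have hB : 0 < B := lt_of_lt_of_le hA hAB
  have hk0 : 0 ≤ k := by linarith
  have hk1 : 0 ≤ k - 1 := by linarith
  -- the constant `C = c / (2B)^k`
  have h2B : 0 < 2 * B := by linarith
  set C : ℝ := c / (2 * B) ^ k with hCdef
  have h2Bk : 0 < (2 * B) ^ k := Real.rpow_pos_of_pos h2B _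
  have hC : 0 < C := div_pos hc h2Bk
  refine ⟨C, hC, fun X₀ => ?_⟩
  -- conductor threshold: `A log q ≥ L₀ := max (log 2) (max X₀ 0)`, so `u ≥ 2` and `u ≥ X₀`
  set L₀ : ℝ := max (Real.log 2) (max X₀ 0) with hL₀def
  have hL₀0 : 0 ≤ L₀ := le_trans (le_max_right _ _) (le_max_right _ _)
  obtain ⟨q, hqne, χ, δ, hq, hprim, hquad, hδ0, hδ1, hzero, hδk⟩ :=
    hz (max q₀ (⌈Real.exp (L₀ / A)⌉₊ + 3))
  have hq₀ : q₀ ≤ q := le_trans (le_max_left _ _) hq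
  have hq3 : 3 ≤ q := by have := le_trans (le_max_right _ _) hq; omega
  have hlog1 : 1 < Real.log q := one_lt_log_of_three_le hq3
  have hlog0 : 0 < Real.log q := by linarith
  have hLA : L₀ ≤ A * Real.log q := by
    have hqexp : Real.exp (L₀ / A) ≤ (q : ℝ) := by
      have h1 : Real.exp (L₀ / A) ≤ (⌈Real.exp (L₀ / A)⌉₊ : ℝ) := Nat.le_ceil _
      have h2 : ((⌈Real.exp (L₀ / A)⌉₊ + 3 : ℕ) : ℝ) ≤ (q : ℝ) := by
        exact_mod_cast le_trans (le_max_right _ _) hq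
      push_cast at h2
      linarith
    have h3 : L₀ / A ≤ Real.log q := by
      rw [Real.le_log_iff_exp_le (by positivity)]
      exact hqexp
    have := mul_le_mul_of_nonneg_left h3 hA.le
    rwa [mul_div_cancel₀ _ hA.ne'] at this
  haveI := hqne
  obtain ⟨u, hupos, hulo, huhi, n, hpX, hgap⟩ := hT q χ δ hq₀ hprim hquad hδ0 hδ1 hzero
  -- `log u ≥ L₀ ≥ log 2`, so `u ≥ 2` and `log u > 0`
  have hlogu : L₀ ≤ Real.log u := hLA.trans hulo
  have hlogu2 : Real.log 2 ≤ Real.log u := (le_max_left _ _).trans hlogu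
  have hlogupos : 0 < Real.log u := lt_of_lt_of_le (Real.log_pos (by norm_num)) hlogu2
  have hlogune : Real.log u ≠ 0 := hlogupos.ne'
  have hδne : δ ≠ 0 := hδ0.ne'
  have hu2 : 2 ≤ u := by
    rwa [Real.log_le_log_iff (by norm_num) hupos] at hlogu2
  have huX₀ : X₀ ≤ u := by
    have h1 : max X₀ 0 ≤ Real.log u := (le_max_right _ _).trans hlogu
    have h2 : X₀ ≤ Real.log u := (le_max_left _ _).trans h1
    have h3 : Real.log u ≤ u := (Real.log_le_sub_one_of_pos hupos).trans (by linarith)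
    linarith
  -- `X = e^{2u}`
  set X : ℝ := Real.exp (2 * u) with hXdef
  have hlogX : Real.log X = 2 * u := by rw [hXdef, Real.log_exp]
  have hXu : u ≤ X := by
    have := Real.add_one_le_exp (2 * u)
    rw [hXdef]; linarith
  refine ⟨X, huX₀.trans hXu, n, hpX, le_trans ?_ hgap⟩
  -- the inequality `C log X (log log X)^{k-1} ≤ c u/(δ log u)`
  -- (1) `1/δ ≥ (log q)^k ≥ (log u / B)^k`
  have hpowq : 0 < Real.log q ^ k := Real.rpow_pos_of_pos hlog0 _
  have hδinv : Real.log q ^ k ≤ 1 / δ := by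
    rw [Real.rpow_neg hlog0.le] at hδk
    rw [le_one_div hpowq hδ0]
    calc δ ≤ (Real.log q ^ k)⁻¹ := hδk
      _ = 1 / Real.log q ^ k := (one_div _).symm
  have hquot0 : 0 ≤ Real.log u / B := div_nonneg hlogupos.le hB.le
  have hquot : Real.log u / B ≤ Real.log q := by
    rw [div_le_iff₀ hB]; linarith
  have hqk : (Real.log u / B) ^ k ≤ Real.log q ^ k := Real.rpow_le_rpow hquot0 hquot hk0
  have hsplitB : (Real.log u / B) ^ k = Real.log u ^ k / B ^ k :=
    Real.div_rpow hlogupos.le hB.le k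
  -- (2) `u/(δ log u) ≥ u (log u)^{k-1} / B^k`
  have hBk : 0 < B ^ k := Real.rpow_pos_of_pos hB _
  have hloguk1 : Real.log u ^ (k - 1) = Real.log u ^ k / Real.log u := by
    rw [Real.rpow_sub hlogupos, Real.rpow_one]
  have hmain : u * Real.log u ^ (k - 1) / B ^ k ≤ u / (δ * Real.log u) := by
    have h1 : Real.log u ^ k / B ^ k ≤ 1 / δ := by
      rw [← hsplitB]; exact hqk.trans hδinv
    -- multiply by `u / log u > 0`
    have h2 := mul_le_mul_of_nonneg_left h1 (div_nonneg hupos.le hlogupos.le)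
    have hl : u / Real.log u * (Real.log u ^ k / B ^ k) = u * Real.log u ^ (k - 1) / B ^ k := by
      rw [hloguk1]; field_simp
    have hr : u / Real.log u * (1 / δ) = u / (δ * Real.log u) := by
      field_simp
    rw [hl, hr] at h2
    exact h2
  -- (3) `log u ≥ ½ log log X` (as `u ≥ 2`: `log(2u) ≤ 2 log u` iff `2u ≤ u²`)
  have hloglogX : Real.log (Real.log X) ≤ 2 * Real.log u := by
    rw [hlogX, ← Real.log_rpow hupos, Real.rpow_two]
    exact Real.log_le_log (by positivity) (by nlinarith)
  have hloglogX0 : 0 ≤ Real.log (Real.log X) := by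
    rw [hlogX]; exact Real.log_nonneg (by linarith)
  have hpowcmp : (Real.log (Real.log X) / 2) ^ (k - 1) ≤ Real.log u ^ (k - 1) :=
    Real.rpow_le_rpow (by positivity) (by linarith) hk1
  have hsplit2 : (Real.log (Real.log X) / 2) ^ (k - 1) =
      Real.log (Real.log X) ^ (k - 1) / 2 ^ (k - 1) :=
    Real.div_rpow hloglogX0 (by norm_num) (k - 1)
  -- (4) assemble: `C log X (log log X)^{k-1} = c/(2B)^k · 2u · (loglog X)^{k-1}`
  --     `= c · u · ((loglog X)/2)^{k-1} / B^k ≤ c · u (log u)^{k-1}/B^k ≤ c · u/(δ log u)`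
  have h2k : (2 : ℝ) ^ k = 2 * 2 ^ (k - 1) := by
    have : k = (k - 1) + 1 := by ring
    rw [this, Real.rpow_add_one (by norm_num : (2 : ℝ) ≠ 0)]; ring
  have h2Bk' : (2 * B) ^ k = 2 ^ k * B ^ k := Real.mul_rpow (by norm_num) hB.le
  have h2k1 : 0 < (2 : ℝ) ^ (k - 1) := Real.rpow_pos_of_pos (by norm_num) _
  have hBkne : B ^ k ≠ 0 := hBk.ne'
  have h2k1ne : (2 : ℝ) ^ (k - 1) ≠ 0 := h2k1.ne'
  have hrewrite : C * (Real.log X * Real.log (Real.log X) ^ (k - 1)) =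
      c * (u * (Real.log (Real.log X) / 2) ^ (k - 1) / B ^ k) := by
    rw [hCdef, h2Bk', h2k, hsplit2, hlogX]
    field_simp
  rw [hrewrite]
  refine mul_le_mul_of_nonneg_left ?_ hc.le
  calc u * (Real.log (Real.log X) / 2) ^ (k - 1) / B ^ k
      ≤ u * Real.log u ^ (k - 1) / B ^ k := by
        apply div_le_div_of_nonneg_right _ hBk.le
        exact mul_le_mul_of_nonneg_left hpowcmp hupos.le
    _ ≤ u / (δ * Real.log u) := hmain

end Ford2020

/-! ### Wright's hypothesis is a case of Ford's (appended 2026-08-26) -/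

/-- **Wright's `StrongSiegelZeros A` (a real zero `β > 1 − (log D)^{−(r^r+A)}` at arbitrarily large
conductors) implies Ford's `PolylogExceptionalZeros (r^r + A)`** for `A ≥ 0`: with `δ = 1 − β` one has
`0 < δ < 1` (`β < 1` since `L(s, χ) ≠ 0` on `Re s ≥ 1`; `β > 0` since `(log D)^{r^r+A} ≥ 1` for
`D ≥ 3`) and `δ < (log D)^{−(r^r+A)}`. Hence (with `Ford2020.largeGaps_of_polylogExceptionalZeros`)
Wright's prime-tuple hypothesis also forces Ford's large prime gaps `G(X) ≫ log X (log log X)^{r^r+A−1}`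
infinitely often, modulo `ford2020_theorem14`. [cite: Ford2019LargePrimeGaps, §1, example after Theorem 1.4]
[cite: Wright2023PrimeTuplesSiegel, §3 Main Result (hypothesis of the first Theorem)] -/
theorem WrightPrimeTuples.StrongSiegelZeros.polylogExceptionalZeros {A : ℝ} (hA : 0 ≤ A)
    (h : WrightPrimeTuples.StrongSiegelZeros A) :
    Ford2020.PolylogExceptionalZeros ((FI2003.r : ℝ) ^ FI2003.r + A) := by
  intro q₀
  obtain ⟨D, instD, χ, β, hD, hprim, hquad, hne, hzero, hβ⟩ := h (max q₀ 3)
  haveI := instD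
  have hD3 : 3 ≤ D := le_trans (le_max_right _ _) hD
  have hD3' : (3 : ℝ) ≤ D := by exact_mod_cast hD3
  have hlog1 : 1 ≤ Real.log D := by
    have hlog3 : 1 < Real.log 3 := by
      rw [Real.lt_log_iff_exp_lt (by norm_num)]
      have := Real.exp_one_lt_d9; linarith
    exact le_trans hlog3.le (Real.log_le_log (by norm_num) hD3')
  have hlogpos : 0 < Real.log D := by linarith
  set N : ℝ := (FI2003.r : ℝ) ^ FI2003.r + A with hNdef
  have hN : 0 ≤ N := by have := FI2003.one_le_r_pow_r; rw [hNdef]; linarith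
  -- `β < 1`: no zeros on `Re s ≥ 1`
  have hβ1 : β < 1 := by
    by_contra hge
    rw [not_lt] at hge
    exact DirichletCharacter.LFunction_ne_zero_of_one_le_re χ (Or.inl hne) (by simpa using hge) hzero
  -- `(log D)^N ≥ 1`, so `1/(log D)^N ≤ 1` and `β > 0`
  have hpow1 : 1 ≤ Real.log D ^ N := Real.one_le_rpow hlog1 hN
  have hpowpos : 0 < Real.log D ^ N := by linarith
  have hβ0 : 0 < β := by
    have : 1 / Real.log D ^ N ≤ 1 := by rw [div_le_one hpowpos]; exact hpow1
    linarith
  refine ⟨D, instD, χ, 1 - β, le_trans (le_max_left _ _) hD, hprim, hquad, by linarith, by linarith,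
    ?_, ?_⟩
  · have hcast : (1 : ℂ) - ((1 - β : ℝ) : ℂ) = (β : ℂ) := by push_cast; ring
    rw [hcast]
    exact hzero
  · -- `1 - β < 1/(log D)^N = (log D)^{-N}`
    rw [Real.rpow_neg hlogpos.le, ← one_div]
    linarith


/-! ### Ford's hypothesis gives back exceptional characters of polylog strength (appended 2026-08-26):
the polylog-scale hypotheses `PolylogExceptionalZeros` and `ExceptionalCharactersOfStrength` are ONE family -/

namespace Ford2020

/-- If `⌈e^T⌉₊ ≤ q` then `T ≤ log q`. [folklore] -/
private theorem le_log_of_ceil_exp_le {T : ℝ} {q : ℕ} (hq : ⌈Real.exp T⌉₊ ≤ q) :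
    T ≤ Real.log q := by
  have h1 : Real.exp T ≤ (q : ℝ) := le_trans (Nat.le_ceil _) (by exact_mod_cast hq)
  have hq0 : (0 : ℝ) < q := lt_of_lt_of_le (Real.exp_pos T) h1
  rw [Real.le_log_iff_exp_le hq0]
  exact h1

/-- **Ford's hypothesis with exponent `k` gives exceptional characters of every strength `A < k − 2`**
(`k > 1`), by the tree's PROVED upper half of Montgomery–Vaughan (11.10)
(`MontgomeryVaughan2007_thm11_4_LOne_exceptional_holds`: `‖L(1,χ)‖ ≤ C₂ (1 − β₁)(log q)²` for an
exceptional zero `β₁ > 1 − c/log 4q` of a quadratic `χ ≠ χ₀`): a zero `1 − δ` with `δ ≤ (log q)^{−k}`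
lies in that range once `(log q)^{k−1} > 3/c` (`log 4q ≤ 3 log q`), and then
`‖L(1,χ)‖ ≤ C₂ (log q)^{2−k} ≤ (log q)^{−A}` once `(log q)^{k−2−A} ≥ C₂`. Converse of `.of_strength`
(which loses one logarithm in the other direction); together they make Ford's example hypothesis and
Merikoski/Friedlander–Iwaniec's strength hypothesis the same family up to the shift of the exponent
(`forall_polylogExceptionalZeros_iff_forall_strength`). [cite: Ford2019LargePrimeGaps, §1, example after Theorem 1.4]
[cite: MontgomeryVaughan2007, Theorem 11.4 (11.10)] -/
theorem PolylogExceptionalZeros.strength {k A : ℝ} (hk : 1 < k) (hAk : A + 2 < k)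
    (h : PolylogExceptionalZeros k) : ExceptionalCharactersOfStrength A := by
  intro q₀
  obtain ⟨c, hc, C₁, C₂, hC₁, hC₂, hMV⟩ := MontgomeryVaughan2007_thm11_4_LOne_exceptional_holds
  have hk1 : 0 < k - 1 := by linarith
  have he : 0 < k - 2 - A := by linarith
  -- threshold on `log q`
  set T : ℝ := max 2 (max ((3 / c + 1) ^ (k - 1)⁻¹) ((max 1 C₂) ^ (k - 2 - A)⁻¹)) with hTdef
  obtain ⟨q, hqne, χ, δ, hq, hprim, hquad, hδ0, hδ1, hzero, hδk⟩ := h (max q₀ (⌈Real.exp T⌉₊))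
  haveI := hqne
  have hlogT : T ≤ Real.log q := le_log_of_ceil_exp_le (le_trans (le_max_right _ _) hq)
  have hT2 : 2 ≤ T := le_max_left _ _
  have hlog2 : 2 ≤ Real.log q := le_trans hT2 hlogT
  have hlog1 : 1 ≤ Real.log q := by linarith
  have hlog0 : 0 < Real.log q := by linarith
  have hq2r : (2 : ℝ) ≤ q := by
    by_contra hlt
    rw [not_le] at hlt
    have hq0 : (0 : ℝ) < q := by
      have : (1 : ℝ) ≤ q := by exact_mod_cast Nat.one_le_iff_ne_zero.mpr (NeZero.ne q)
      linarith
    have : Real.log q < Real.log 2 := Real.log_lt_log hq0 hlt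
    have h2 : Real.log 2 < 1 := by
      have := Real.log_two_lt_d9; linarith
    linarith
  have hq2 : 2 ≤ q := by exact_mod_cast hq2r
  -- `χ ≠ 1`: a primitive character of modulus `≥ 2` is not principal
  have hne : χ ≠ 1 := by
    intro hχ
    have hcond : χ.conductor = q := (DirichletCharacter.isPrimitive_def χ).mp hprim
    rw [hχ, DirichletCharacter.conductor_one] at hcond
    omega
  -- (a) the zero `1 − δ` is exceptional in Montgomery–Vaughan's sense: `δ < c/log 4q`
  have hpowk : 0 < Real.log q ^ k := Real.rpow_pos_of_pos hlog0 _
  have hδ' : δ ≤ 1 / Real.log q ^ k := by rwa [Real.rpow_neg hlog0.le, ← one_div] at hδk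
  have hkm1 : 3 / c < Real.log q ^ (k - 1) := by
    have hT' : (3 / c + 1) ^ (k - 1)⁻¹ ≤ Real.log q :=
      le_trans (le_trans (le_max_left _ _) (le_max_right _ _)) hlogT
    have hpos : 0 ≤ 3 / c + 1 := by positivity
    have h1 : ((3 / c + 1) ^ (k - 1)⁻¹) ^ (k - 1) ≤ Real.log q ^ (k - 1) :=
      Real.rpow_le_rpow (Real.rpow_nonneg hpos _) hT' hk1.le
    rw [Real.rpow_inv_rpow hpos hk1.ne'] at h1
    linarith
  have hsplitk : Real.log q ^ k = Real.log q ^ (k - 1) * Real.log q := by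
    have : k = (k - 1) + 1 := by ring
    conv_lhs => rw [this, Real.rpow_add hlog0, Real.rpow_one]
  have hlog4q : Real.log (4 * q) ≤ 3 * Real.log q := log_four_mul_le_three_mul_log hq2r
  have hlog4q0 : 0 < Real.log (4 * q) := by
    have : (1 : ℝ) < 4 * q := by linarith
    exact Real.log_pos this
  have hδc : δ < c / Real.log (4 * q) := by
    have h1 : 1 / Real.log q ^ k < c / (3 * Real.log q) := by
      rw [hsplitk, div_lt_div_iff₀ (by positivity) (by positivity)]
      have h3 : 3 < c * Real.log q ^ (k - 1) := by
        have := (div_lt_iff₀ hc).1 hkm1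
        linarith [mul_comm c (Real.log q ^ (k - 1))]
      nlinarith
    have h2 : c / (3 * Real.log q) ≤ c / Real.log (4 * q) :=
      div_le_div_of_nonneg_left hc.le hlog4q0 hlog4q
    linarith
  have hβlo : 1 - c / Real.log (4 * q) < 1 - δ := by linarith
  have hβhi : 1 - δ < 1 := by linarith
  have hzero' : χ.LFunction ((1 - δ : ℝ) : ℂ) = 0 := by
    have hcast : ((1 - δ : ℝ) : ℂ) = 1 - (δ : ℂ) := by push_cast; ring
    rw [hcast]; exact hzero
  obtain ⟨-, hupper⟩ := hMV q χ hne hquad (1 - δ) hβlo hβhi hzero'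
  -- (b) `‖L(1,χ)‖ ≤ C₂ δ (log q)² ≤ C₂ (log q)^{2−k} ≤ (log q)^{−A}`
  have hupper' : ‖χ.LFunction 1‖ ≤ C₂ * δ * Real.log q ^ 2 := by
    have : (1 - (1 - δ)) = δ := by ring
    rwa [this] at hupper
  have hstep1 : C₂ * δ * Real.log q ^ 2 ≤ C₂ * Real.log q ^ (2 - k) := by
    have hsq : Real.log q ^ (2 : ℕ) = Real.log q ^ (2 : ℝ) := by
      rw [← Real.rpow_natCast]; norm_num
    have h2k : Real.log q ^ (2 - k) = (1 / Real.log q ^ k) * Real.log q ^ (2 : ℝ) := by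
      rw [show (2 : ℝ) - k = -k + 2 by ring, Real.rpow_add hlog0, Real.rpow_neg hlog0.le, one_div]
    rw [hsq, h2k, mul_assoc]
    apply mul_le_mul_of_nonneg_left _ hC₂.le
    exact mul_le_mul_of_nonneg_right hδ' (Real.rpow_nonneg hlog0.le _)
  have hstep2 : C₂ * Real.log q ^ (2 - k) ≤ Real.log q ^ (-A) := by
    have hT' : (max 1 C₂) ^ (k - 2 - A)⁻¹ ≤ Real.log q :=
      le_trans (le_trans (le_max_right _ _) (le_max_right _ _)) hlogT
    have hpos : 0 ≤ max 1 C₂ := le_trans zero_le_one (le_max_left _ _)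
    have h1 : ((max 1 C₂) ^ (k - 2 - A)⁻¹) ^ (k - 2 - A) ≤ Real.log q ^ (k - 2 - A) :=
      Real.rpow_le_rpow (Real.rpow_nonneg hpos _) hT' he.le
    rw [Real.rpow_inv_rpow hpos he.ne'] at h1
    have hC₂' : C₂ ≤ Real.log q ^ (k - 2 - A) := le_trans (le_max_right _ _) h1
    have hsplit : Real.log q ^ (-A) = Real.log q ^ (k - 2 - A) * Real.log q ^ (2 - k) := by
      rw [← Real.rpow_add hlog0]; ring_nf
    rw [hsplit]
    exact mul_le_mul_of_nonneg_right hC₂' (Real.rpow_nonneg hlog0.le _)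
  exact ⟨q, hqne, χ, le_trans (le_max_left _ _) hq, hprim, hne, hquad,
    hupper'.trans (hstep1.trans hstep2)⟩

/-- **Ford's hypothesis with exponent `k > 3` gives Friedlander–Iwaniec's `SmallEtaCharacters ε` for
every `ε > 0`** (`η(D) = ‖L(1,χ_D)‖ log D → 0` along the witnesses): strength `(k − 1)/2 > 1` from
`.strength`, then `smallEtaCharacters_of_exceptionalCharactersOfStrength`. So every consequence the
column types on `SmallEtaCharacters` (twin primes via Friedlander–Iwaniec 2019, Kloosterman-sum
cancellation via Drappeau–Maynard 2019, …) is also a consequence of «infinitely many exceptional zeros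
with `δ_q ≤ (log q)^{−k}`», `k > 3`. [cite: Ford2019LargePrimeGaps, §1, example after Theorem 1.4]
[cite: FriedlanderIwaniec2019TwinPrimes, (1.6)] -/
theorem PolylogExceptionalZeros.smallEtaCharacters {k : ℝ} (hk : 3 < k)
    (h : PolylogExceptionalZeros k) {ε : ℝ} (hε : 0 < ε) : SmallEtaCharacters ε :=
  smallEtaCharacters_of_exceptionalCharactersOfStrength (A := (k - 1) / 2) (by linarith)
    (h.strength (by linarith) (by linarith)) hε

/-- **The two polylog-scale families coincide once closed over the exponent**: «Ford's hypothesis for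
every `k`» ⇔ «exceptional characters of every strength» (`.of_strength`: strength `k + 1` ⇒ exponent
`k`; `.strength`: exponent `k` ⇒ every strength `< k − 2`). [cite: Ford2019LargePrimeGaps, §1, example after Theorem 1.4]
[cite: Merikoski2024ExceptionalCharacters, §1 (1.1)] -/
theorem forall_polylogExceptionalZeros_iff_forall_strength :
    (∀ k : ℝ, PolylogExceptionalZeros k) ↔ (∀ A : ℝ, ExceptionalCharactersOfStrength A) := by
  constructor
  · intro h A
    exact (h (|A| + 3)).strength (by linarith [abs_nonneg A]) (by linarith [le_abs_self A])
  · intro h k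
    by_cases hk : 2 ≤ k
    · exact PolylogExceptionalZeros.of_strength hk (h (k + 1))
    · exact (PolylogExceptionalZeros.of_strength le_rfl (h (2 + 1))).anti (by linarith)

end Ford2020

end Literature.NumberTheory.LFunctions

end
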